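import Literature.Barriers.CriticalPhenomena.LongRangeTrivialityOnZ3Torus
import Mathlib.Analysis.Convex.SpecificFunctions.Basic
import Mathlib.Analysis.Convex.Jensen

/-!
# The torus zero mode vanishes below `β_c` for long-range pair interactions:
# `N^{-2d}⟨(∑_{a∈𝕋_N}σ_a)²⟩_{𝕋_N,J^{(N)},β} → 0` when `m*(β) = 0` (pressure argument)

Sibling of `Literature/Barriers/CriticalPhenomena/LongRangeTrivialityOnZ3Torus.lean` (barrier catalogue
D-0021, sub-problem `Ising3DConformalLimit`), second file of the torus route to Panis's infrared bound
`panis_infraredBound_algebraic` (arXiv:2309.05797, Proposition 3.8 / §3.6). Panis transfers the torus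
infrared bound (Proposition 3.4) to `ℤ^d` through Proposition 3.7, whose proof uses the uniqueness of
the infinite-volume state and the finiteness of the susceptibility below `β_c` [Aizenman–Barsky–
Fernández 1987] together with the Simon–Lieb inequality — i.e. the SHARPNESS of the phase transition,
for a `β_c` defined (§1.2.1) as the onset of the magnetisation `m*(β) = lim_{h↓0}⟨σ₀⟩_{β,h}`. For the
`x`-space form of the bound only the vanishing of the ZERO MODE of the torus two-point function is
needed (this is (3.17) of Aizenman–Duminil-Copin–Sidoravicius 2015, §3.3, in the nearest-neighbour
case, where the tree proves it by a two-box decoupling argument, `TorusZeroMode.lean`, that is not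
available for long-range couplings). This file PROVES it for every ferromagnetic, translation-invariant,
summable pair interaction `J` on `ℤ^d`, directly from `m*(β) = 0`, by the classical pressure
(Griffiths 1966) argument, entirely in finite volume:

1. `log(Z_{𝕋_N}(h)/Z_{𝕋_N}(0)) ≥ βh⟨|M|⟩_{𝕋_N,0} - log 2` (`M = ∑_aσ_a`): spin-flip symmetry makes
   `Z(h)/Z(0) = ⟨cosh(βhM)⟩₀ ≥ ½⟨e^{βh|M|}⟩₀`, then Jensen (`mul_torusExpect_abs_le_log`);
2. the torus weights of `J^{(N)}` and of the free cube `[0,N)^d` (transported, `cubeCoupling`) differ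
   by at most `e^{±βD_N/2}`, `D_N = ∑_{a,b}(J^{(N)}-J)_{a,b} = ∑_{x∈[0,N)^d}∑_{w∉[0,N)^d}J_{x,w}`
   (`couplingDefect`), so `Z_per(h)/Z_per(0) ≤ e^{βD_N}Z_free(h)/Z_free(0)`
   (`partitionRatio_le_exp_mul`);
3. Jensen at field `h`: `Z_free(h)/Z_free(0) ≤ exp(βh⟨M⟩_{free,h})` (`log_partitionRatio_le`), and
   Griffiths (volume monotonicity, translation invariance): `⟨M⟩_{free,h} ≤ N^d m(h)`,
   `m(h) = ⟨σ₀⟩_{J,h,β}` (`torusExpect_cubeCoupling_totalSpin_le`);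
4. hence `⟨M²⟩_{𝕋_N,0} ≤ N^d⟨|M|⟩_{𝕋_N,0} ≤ N^{2d}m(h) + N^d(D_N/h + log 2/(βh))`
   (`torusExpect_totalSpin_sq_le`);
5. `D_N = o(N^d)` for summable `J` (`couplingDefect_le_eventually`: sites at distance `≥ K` from the
   complement contribute at most the tail `∑_{u∉Λ_K}J_{0,u}`, the others at most `|J|` each), and
   `m(h) ↓ m*(β) = 0` as `h ↓ 0`;

whence **`torusExpect_totalSpin_sq_le_eventually`** (`d ≥ 1`): if `m*(β) = 0` (in particular for
`0 < β < β_c`, `magnetization_eq_zero_of_lt_criticalBeta`) then for every `ε > 0`,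
`⟨(∑_aσ_a)²⟩_{𝕋_N,J^{(N)},0,β} ≤ εN^{2d}` for all large `N`; and the zero-mode form
`∑_{u∈𝕋_N}⟨σ₀σ_u⟩_{𝕋_N} ≤ εN^d` (`torus_zeroMode_le_eventually`, by translation invariance
`⟨M²⟩ = N^d∑_u⟨σ₀σ_u⟩`, `torusExpect_totalSpin_sq_eq`). No sharpness, uniqueness or Simon–Lieb
input is used. Everything is PROVED.

## References

* R. Panis, arXiv:2309.05797 (2023) = Ann. Probab. 54 (2026), §1.2.1 (`m*(β)`, `β_c`), §3.1
  (`J^{(L)}`, `⟨·⟩_{𝕋_L,ρ,β}`), Prop. 3.7 (the input replaced here) [Panis2023Triviality] (held; read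
  pp. 5–6, 13–15).
* M. Aizenman, H. Duminil-Copin, V. Sidoravicius, CMP 334 (2015), §3.3 eq. (3.17) (the zero-mode
  statement, nearest-neighbour case) [AizenmanDuminilCopinSidoraviciusCMP2015].
* R. B. Griffiths, Phys. Rev. 152 (1966) 240–246 (spontaneous magnetisation and long-range order
  from the pressure; steps 1–3 are that standard argument, re-proved here in finite volume);
  S. Friedli, Y. Velenik, *Statistical Mechanics of Lattice Systems*, CUP (2017), §3.8.1
  (Griffiths' inequalities) [FriedliVelenik2017].
-/

noncomputable section

namespace Literature.Barriers.CriticalPhenomena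

open Literature.Probability.LatticeModels Literature.Probability.Percolation Filter Topology Finset
open scoped symmDiff

namespace LongRangeIsing

variable {d : ℕ}

/-! ### The total spin and the field dependence of the torus weights -/

section TotalSpin

variable {N : ℕ} [NeZero N] (c : TorusSite d N → TorusSite d N → ℝ) (β h : ℝ)

/-- The total spin `M(σ) = ∑_{a∈𝕋_N} σ_a`. [cite: Panis2023Triviality, §3.3 (τ̂(0) ∝ ∑_x τ_x, the zero mode)] -/
def totalSpin (σ : SpinConfig (TorusSite d N)) : ℝ := ∑ a, spinAt a σ

/-- `|𝕋_N| = N^d`. [folklore] -/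
theorem card_torus : Fintype.card (TorusSite d N) = N ^ d := by
  rw [Fintype.card_fun, ZMod.card, Fintype.card_fin]

/-- `|M| ≤ N^d`. [folklore] -/
theorem abs_totalSpin_le (σ : SpinConfig (TorusSite d N)) : |totalSpin σ| ≤ (N : ℝ) ^ d := by
  rw [totalSpin]
  refine (Finset.abs_sum_le_sum_abs _ _).trans ?_
  have h : ∑ a : TorusSite d N, |spinAt a σ| = (N : ℝ) ^ d := by
    simp only [abs_spinAt, Finset.sum_const, Finset.card_univ, card_torus, nsmul_eq_mul, mul_one]
    push_cast
    ring
  rw [h]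

/-- `M² ≤ N^d |M|`. [folklore] -/
theorem totalSpin_sq_le (σ : SpinConfig (TorusSite d N)) : totalSpin σ ^ 2 ≤ (N : ℝ) ^ d * |totalSpin σ| := by
  rw [← sq_abs, sq]
  exact mul_le_mul_of_nonneg_right (abs_totalSpin_le σ) (abs_nonneg _)

/-- `M(-σ) = -M(σ)`. [folklore] -/
theorem totalSpin_neg (σ : SpinConfig (TorusSite d N)) : totalSpin (-σ) = -totalSpin σ := by
  simp only [totalSpin, spinAt_neg_torus, Finset.sum_neg_distrib]

/-- The field enters the energy through `-hM`. [folklore] -/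
theorem torusHamiltonian_eq_sub_field (σ : SpinConfig (TorusSite d N)) :
    torusHamiltonian c h σ = torusHamiltonian c 0 σ - h * totalSpin σ := by
  simp only [torusHamiltonian, totalSpin, zero_mul, sub_zero]

/-- Changing the field multiplies the weight by `exp(β(h'-h)M)`. [folklore] -/
theorem torusWeight_field (h' : ℝ) (σ : SpinConfig (TorusSite d N)) :
    torusWeight c β h' σ = torusWeight c β h σ * Real.exp (β * (h' - h) * totalSpin σ) := by
  rw [torusWeight, torusWeight, ← Real.exp_add, torusHamiltonian_eq_sub_field c h', torusHamiltonian_eq_sub_field c h]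
  congr 1
  ring

/-- **`Z(h') = Z(h)⟨exp(β(h'-h)M)⟩_h`.** [folklore] -/
theorem torusPartition_eq_mul_torusExpect_exp (h' : ℝ) :
    torusPartition c β h' = torusPartition c β h * torusExpect c β h (fun σ => Real.exp (β * (h' - h) * totalSpin σ)) := by
  rw [torusExpect, mul_div_cancel₀ _ (torusPartition_pos c β h).ne', torusPartition]
  exact Finset.sum_congr rfl fun σ _ => by rw [torusWeight_field c β h h', mul_comm]

/-- **Jensen's inequality for the torus state**: `exp⟨F⟩ ≤ ⟨exp F⟩`. [folklore] -/
theorem exp_torusExpect_le (F : SpinConfig (TorusSite d N) → ℝ) :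
    Real.exp (torusExpect c β h F) ≤ torusExpect c β h (fun σ => Real.exp (F σ)) := by
  set p : SpinConfig (TorusSite d N) → ℝ := fun σ => torusWeight c β h σ / torusPartition c β h with hp
  have hp0 : ∀ σ ∈ (univ : Finset (SpinConfig (TorusSite d N))), 0 ≤ p σ :=
    fun σ _ => div_nonneg (torusWeight_pos c β h σ).le (torusPartition_pos c β h).le
  have hp1 : ∑ σ, p σ = 1 := by
    rw [hp]
    simp only
    rw [← Finset.sum_div, ← torusPartition, div_self (torusPartition_pos c β h).ne']
  have hrepr : ∀ G : SpinConfig (TorusSite d N) → ℝ, torusExpect c β h G = ∑ σ, p σ • G σ := by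
    intro G
    rw [torusExpect, Finset.sum_div]
    refine Finset.sum_congr rfl fun σ _ => ?_
    rw [hp, smul_eq_mul]
    ring
  rw [hrepr F, hrepr]
  exact convexOn_exp.map_sum_le hp0 hp1 fun σ _ => Set.mem_univ _

/-- `½ e^{|t|} ≤ cosh t`. [folklore] -/
theorem exp_abs_le_two_mul_cosh (t : ℝ) : Real.exp |t| ≤ 2 * Real.cosh t := by
  rw [Real.cosh_eq, mul_div_cancel₀ _ (two_ne_zero)]
  rcases le_or_gt 0 t with ht | ht
  · rw [abs_of_nonneg ht]
    linarith [Real.exp_pos (-t)]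
  · rw [abs_of_neg ht]
    linarith [Real.exp_pos t]

/-- **Step 1 (symmetry and Jensen)**: at zero field, for `β, h ≥ 0`,
`βh⟨|M|⟩_{𝕋_N,c,0,β} ≤ log 2 + log(Z(h)/Z(0))`: by the spin flip `Z(h)/Z(0) = ⟨cosh(βhM)⟩₀ ≥
½⟨e^{βh|M|}⟩₀`, and Jensen. [cite: Panis2023Triviality, §1.2.1 (m*(β), β_c); pressure argument of Griffiths 1966] -/
theorem mul_torusExpect_abs_le_log (hβ : 0 ≤ β) (hh : 0 ≤ h) :
    β * h * torusExpect c β 0 (fun σ => |totalSpin σ|) ≤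
      Real.log 2 + Real.log (torusPartition c β h / torusPartition c β 0) := by
  set E : ℝ := torusExpect c β 0 (fun σ => Real.exp (β * h * totalSpin σ)) with hE
  have hratio : torusPartition c β h / torusPartition c β 0 = E := by
    rw [torusPartition_eq_mul_torusExpect_exp c β 0 h, sub_zero, mul_div_cancel_left₀ _ (torusPartition_pos c β 0).ne']
  -- flip symmetry: `E = ⟨exp(-βhM)⟩₀`, hence `E = ⟨cosh(βhM)⟩₀`
  have hflip : E = torusExpect c β 0 (fun σ => Real.exp (-(β * h * totalSpin σ))) := by
    rw [hE, ← torusExpect_comp_neg c β (fun σ => Real.exp (β * h * totalSpin σ))]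
    refine congrArg _ (funext fun σ => ?_)
    rw [totalSpin_neg, mul_neg]
  have hcosh : E = torusExpect c β 0 (fun σ => Real.cosh (β * h * totalSpin σ)) := by
    have h2 : 2 * E = torusExpect c β 0 (fun σ => Real.exp (β * h * totalSpin σ)) +
        torusExpect c β 0 (fun σ => Real.exp (-(β * h * totalSpin σ))) := by rw [← hflip, hE]; ring
    rw [← torusExpect_add] at h2
    have h3 : E = 1 / 2 * torusExpect c β 0
        (fun σ => Real.exp (β * h * totalSpin σ) + Real.exp (-(β * h * totalSpin σ))) := by
      linarith
    rw [h3, ← torusExpect_const_mul]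
    refine congrArg _ (funext fun σ => ?_)
    rw [Real.cosh_eq]
    ring
  -- `2E ≥ ⟨exp(βh|M|)⟩₀ ≥ exp(βh⟨|M|⟩₀)`
  have hlow : Real.exp (β * h * torusExpect c β 0 (fun σ => |totalSpin σ|)) ≤ 2 * E := by
    have j := exp_torusExpect_le c β 0 (fun σ => β * h * |totalSpin σ|)
    rw [torusExpect_const_mul] at j
    refine j.trans ?_
    rw [hcosh, ← torusExpect_const_mul]
    refine torusExpect_mono c β 0 fun σ => ?_
    have h1 := exp_abs_le_two_mul_cosh (β * h * totalSpin σ)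
    rwa [abs_mul, abs_of_nonneg (mul_nonneg hβ hh)] at h1
  have hEpos : 0 < E := by
    have := exp_torusExpect_le c β 0 (fun σ => β * h * totalSpin σ)
    exact lt_of_lt_of_le (Real.exp_pos _) this
  rw [hratio, ← Real.log_mul two_ne_zero hEpos.ne']
  exact (Real.le_log_iff_exp_le (by positivity)).2 hlow

/-- **Step 3 (Jensen at field `h`)**: `log(Z(h)/Z(0)) ≤ βh⟨M⟩_{𝕋_N,c,h,β}`. [folklore] -/
theorem log_partitionRatio_le :
    Real.log (torusPartition c β h / torusPartition c β 0) ≤ β * h * torusExpect c β h totalSpin := by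
  -- `Z(0) = Z(h)⟨exp(-βhM)⟩_h ≥ Z(h)exp(-βh⟨M⟩_h)`
  have hZ := torusPartition_eq_mul_torusExpect_exp c β h 0
  have j := exp_torusExpect_le c β h (fun σ => β * (0 - h) * totalSpin σ)
  rw [torusExpect_const_mul] at j
  have hpos := torusPartition_pos c β h
  have h0pos := torusPartition_pos c β 0
  have h1 : torusPartition c β h * Real.exp (β * (0 - h) * torusExpect c β h totalSpin) ≤ torusPartition c β 0 := by
    rw [hZ]
    exact mul_le_mul_of_nonneg_left j hpos.le
  have h2 : torusPartition c β h / torusPartition c β 0 ≤ Real.exp (β * h * torusExpect c β h totalSpin) := by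
    rw [div_le_iff₀ h0pos]
    have h3 : Real.exp (β * h * torusExpect c β h totalSpin) * (torusPartition c β h *
        Real.exp (β * (0 - h) * torusExpect c β h totalSpin)) = torusPartition c β h := by
      rw [mul_comm, mul_assoc, ← Real.exp_add]
      have : β * (0 - h) * torusExpect c β h totalSpin + β * h * torusExpect c β h totalSpin = 0 := by ring
      rw [this, Real.exp_zero, mul_one]
    calc torusPartition c β h = Real.exp (β * h * torusExpect c β h totalSpin) *
          (torusPartition c β h * Real.exp (β * (0 - h) * torusExpect c β h totalSpin)) := h3.symm
      _ ≤ Real.exp (β * h * torusExpect c β h totalSpin) * torusPartition c β 0 :=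
          mul_le_mul_of_nonneg_left h1 (Real.exp_pos _).le
  calc Real.log (torusPartition c β h / torusPartition c β 0)
      ≤ Real.log (Real.exp (β * h * torusExpect c β h totalSpin)) :=
        Real.log_le_log (div_pos hpos h0pos) h2
    _ = β * h * torusExpect c β h totalSpin := Real.log_exp _

end TotalSpin

/-! ### Step 2: comparison of the partition functions of two coupling matrices -/

section Compare

variable {N : ℕ} [NeZero N] (β : ℝ)

/-- Energies of two coupling matrices `c' ≤ c` differ by at most half the total coupling defect:
`|H_c(σ) - H_{c'}(σ)| ≤ ½∑_{a,b}(c - c')_{a,b}`. [folklore] -/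
theorem abs_torusHamiltonian_sub_le {c c' : TorusSite d N → TorusSite d N → ℝ} (hcc' : ∀ a b, c' a b ≤ c a b)
    (h : ℝ) (σ : SpinConfig (TorusSite d N)) :
    |torusHamiltonian c h σ - torusHamiltonian c' h σ| ≤ (∑ a, ∑ b, (c a b - c' a b)) / 2 := by
  have e : torusHamiltonian c h σ - torusHamiltonian c' h σ =
      -(∑ a, ∑ b, (c a b - c' a b) * (spinAt a σ * spinAt b σ)) / 2 := by
    simp only [torusHamiltonian, sub_mul, Finset.sum_sub_distrib, mul_assoc]
    ring
  rw [e, abs_div, abs_neg, abs_two]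
  refine div_le_div_of_nonneg_right ((Finset.abs_sum_le_sum_abs _ _).trans (Finset.sum_le_sum fun a _ =>
    (Finset.abs_sum_le_sum_abs _ _).trans (Finset.sum_le_sum fun b _ => ?_))) zero_le_two
  rw [abs_mul, abs_mul, abs_spinAt, abs_spinAt, mul_one, mul_one, abs_of_nonneg (sub_nonneg.2 (hcc' a b))]

/-- Hence the partition functions compare within `exp(βD/2)` whenever `∑_{a,b}(c - c')_{a,b} ≤ D`:
`Z_c(h) ≤ e^{βD/2}Z_{c'}(h)` and `Z_{c'}(h) ≤ e^{βD/2}Z_c(h)` (`β ≥ 0`). [folklore] -/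
theorem torusPartition_le_exp_mul {c c' : TorusSite d N → TorusSite d N → ℝ} (hcc' : ∀ a b, c' a b ≤ c a b)
    (hβ : 0 ≤ β) {D : ℝ} (hD : ∑ a, ∑ b, (c a b - c' a b) ≤ D) (h : ℝ) :
    torusPartition c β h ≤ Real.exp (β * D / 2) * torusPartition c' β h ∧
      torusPartition c' β h ≤ Real.exp (β * D / 2) * torusPartition c β h := by
  have hw : ∀ σ, torusWeight c β h σ ≤ Real.exp (β * D / 2) * torusWeight c' β h σ ∧
      torusWeight c' β h σ ≤ Real.exp (β * D / 2) * torusWeight c β h σ := by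
    intro σ
    have hb := abs_le.1 ((abs_torusHamiltonian_sub_le hcc' h σ).trans (div_le_div_of_nonneg_right hD zero_le_two))
    rw [torusWeight, torusWeight, ← Real.exp_add, ← Real.exp_add]
    constructor <;> apply Real.exp_le_exp.2 <;> nlinarith [hb.1, hb.2]
  constructor
  · rw [torusPartition, torusPartition, Finset.mul_sum]
    exact Finset.sum_le_sum fun σ _ => (hw σ).1
  · rw [torusPartition, torusPartition, Finset.mul_sum]
    exact Finset.sum_le_sum fun σ _ => (hw σ).2

/-- **Step 2**: `Z_c(h)/Z_c(0) ≤ e^{βD} Z_{c'}(h)/Z_{c'}(0)` for `c' ≤ c`, `∑(c - c') ≤ D`, `β ≥ 0`. [folklore] -/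
theorem partitionRatio_le_exp_mul {c c' : TorusSite d N → TorusSite d N → ℝ} (hcc' : ∀ a b, c' a b ≤ c a b)
    (hβ : 0 ≤ β) {D : ℝ} (hD : ∑ a, ∑ b, (c a b - c' a b) ≤ D) (h : ℝ) :
    torusPartition c β h / torusPartition c β 0 ≤
      Real.exp (β * D) * (torusPartition c' β h / torusPartition c' β 0) := by
  obtain ⟨h1, -⟩ := torusPartition_le_exp_mul β hcc' hβ hD h
  obtain ⟨-, h2⟩ := torusPartition_le_exp_mul β hcc' hβ hD 0
  have hc0 := torusPartition_pos c β 0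
  have hc'0 := torusPartition_pos c' β 0
  have h3 : torusPartition c β h / torusPartition c β 0 ≤
      (Real.exp (β * D / 2) * torusPartition c' β h) / torusPartition c β 0 :=
    div_le_div_of_nonneg_right h1 hc0.le
  have h4 : (Real.exp (β * D / 2) * torusPartition c' β h) / torusPartition c β 0 ≤
      (Real.exp (β * D / 2) * torusPartition c' β h) * (Real.exp (β * D / 2) / torusPartition c' β 0) := by
    rw [div_eq_mul_one_div]
    refine mul_le_mul_of_nonneg_left ?_ (mul_nonneg (Real.exp_pos _).le (torusPartition_pos c' β h).le)
    rw [div_le_div_iff₀ hc0 hc'0, one_mul]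
    exact h2
  refine h3.trans (h4.trans (le_of_eq ?_))
  rw [show β * D = β * D / 2 + β * D / 2 by ring, Real.exp_add]
  ring

end Compare

/-! ### Step 3 continued: the transported free cube model and Griffiths' bound on its magnetisation -/

section FreeCube

variable (J : Site d → Site d → ℝ) (N : ℕ) [NeZero N] (β h : ℝ)

/-- `σ_a` on the torus is the transported one-point function of the cube at `ã`. [folklore] -/
theorem torusExpect_cubeCoupling_spinAt (a : TorusSite d N) :
    torusExpect (cubeCoupling J N) β h (spinAt a) = expectIn J (halfOpenBox d N) β h (spinAt (torusLift N a)) := by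
  have hA : ({torusLift N a} : Finset (Site d)) ⊆ halfOpenBox d N :=
    Finset.singleton_subset_iff.2 (torusLift_mem_halfOpenBox N a)
  rw [← spinProduct_singleton_eq_spinAt, ← spinProduct_singleton_eq_spinAt,
    expectIn_halfOpenBox_spinProduct_eq J N β h hA, Finset.image_singleton, proj_torusLift]

/-- **Griffiths' bound on the free cube magnetisation**: `⟨M⟩_{𝕋_N,cubeCoupling,h,β} ≤ N^d ⟨σ₀⟩_{J,h,β}`
(`β, h ≥ 0`, `J ≥ 0` translation invariant): each `⟨σ_x⟩^free_{[0,N)^d} ≤ ⟨σ_x⟩_{J,h,β} = ⟨σ₀⟩_{J,h,β}`.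
[cite: FriedliVelenik2017, Exercise 3.12, p. 112] -/
theorem torusExpect_cubeCoupling_totalSpin_le (hβ : 0 ≤ β) (hh : 0 ≤ h) (hJ : ∀ x y, 0 ≤ J x y)
    (hJt : ∀ a x y, J (x + a) (y + a) = J x y) :
    torusExpect (cubeCoupling J N) β h totalSpin ≤ (N : ℝ) ^ d * state J β h (spinAt 0) := by
  have h1 : torusExpect (cubeCoupling J N) β h totalSpin = ∑ a : TorusSite d N, torusExpect (cubeCoupling J N) β h (spinAt a) := by
    rw [← torusExpect_finset_sum]
    rfl
  rw [h1]
  have h2 : ∀ a : TorusSite d N, torusExpect (cubeCoupling J N) β h (spinAt a) ≤ state J β h (spinAt 0) := by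
    intro a
    rw [torusExpect_cubeCoupling_spinAt, ← state_spinAt_eq_state_spinAt_zero J β h hβ hh hJ hJt (torusLift N a),
      ← spinProduct_singleton_eq_spinAt]
    exact expectIn_le_state_field J β h hβ hh hJ (Finset.singleton_subset_iff.2 (torusLift_mem_halfOpenBox N a))
  calc ∑ a : TorusSite d N, torusExpect (cubeCoupling J N) β h (spinAt a)
      ≤ ∑ _a : TorusSite d N, state J β h (spinAt 0) := Finset.sum_le_sum fun a _ => h2 a
    _ = (N : ℝ) ^ d * state J β h (spinAt 0) := by
        rw [Finset.sum_const, Finset.card_univ, card_torus, nsmul_eq_mul]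
        push_cast
        ring

end FreeCube

/-! ### Step 4: the bound on `⟨M²⟩_{𝕋_N,J^{(N)},0,β}` at fixed `N` and `h` -/

section FixedN

variable (J : Site d → Site d → ℝ) (N : ℕ) [NeZero N] (β : ℝ)

/-- The coupling defect `D_N = ∑_{a,b∈𝕋_N}(J^{(N)}_{a,b} - J_{ã,b̃}) ≥ 0` (the wrap-around couplings).
[cite: Panis2023Triviality, §3.1 (J^{(L)})] -/
def couplingDefect : ℝ := ∑ a : TorusSite d N, ∑ b : TorusSite d N, (torusCoupling J N a b - cubeCoupling J N a b)

/-- **Step 4**: for `β, h > 0`, `J ≥ 0` translation invariant with `J_{0,·}` summable,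
`⟨|M|⟩_{𝕋_N,J^{(N)},0,β} ≤ N^d⟨σ₀⟩_{J,h,β} + D_N/h + log 2/(βh)`. [cite: Panis2023Triviality, §1.2.1 (m*(β)); pressure argument of Griffiths 1966] -/
theorem torusExpect_abs_totalSpin_le (hβ : 0 < β) {h : ℝ} (hh : 0 < h) (hJ : ∀ x y, 0 ≤ J x y)
    (hJt : ∀ a x y, J (x + a) (y + a) = J x y) (hJs : Summable (J 0)) :
    torusExpect (torusCoupling J N) β 0 (fun σ => |totalSpin σ|) ≤
      (N : ℝ) ^ d * state J β h (spinAt 0) + couplingDefect J N / h + Real.log 2 / (β * h) := by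
  have hcc' : ∀ a b, cubeCoupling J N a b ≤ torusCoupling J N a b := cubeCoupling_le_torusCoupling J N hJ hJt hJs
  have s1 := mul_torusExpect_abs_le_log (torusCoupling J N) β h hβ.le hh.le
  have s2 := partitionRatio_le_exp_mul β hcc' hβ.le (D := couplingDefect J N) le_rfl h
  have s3 := log_partitionRatio_le (cubeCoupling J N) β h
  have s4 := torusExpect_cubeCoupling_totalSpin_le J N β h hβ.le hh.le hJ hJt
  have hposf : 0 < torusPartition (cubeCoupling J N) β h / torusPartition (cubeCoupling J N) β 0 :=
    div_pos (torusPartition_pos _ β h) (torusPartition_pos _ β 0)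
  have hposp : 0 < torusPartition (torusCoupling J N) β h / torusPartition (torusCoupling J N) β 0 :=
    div_pos (torusPartition_pos _ β h) (torusPartition_pos _ β 0)
  -- take logarithms in step 2
  have s2' : Real.log (torusPartition (torusCoupling J N) β h / torusPartition (torusCoupling J N) β 0) ≤
      β * couplingDefect J N + Real.log (torusPartition (cubeCoupling J N) β h / torusPartition (cubeCoupling J N) β 0) := by
    have := Real.log_le_log hposp s2
    rwa [Real.log_mul (Real.exp_pos _).ne' hposf.ne', Real.log_exp] at this
  have hβh : 0 < β * h := mul_pos hβ hh
  -- combine: `βh⟨|M|⟩ ≤ log 2 + βD + βh N^d m(h)`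
  have key : β * h * torusExpect (torusCoupling J N) β 0 (fun σ => |totalSpin σ|) ≤
      Real.log 2 + β * couplingDefect J N + β * h * ((N : ℝ) ^ d * state J β h (spinAt 0)) := by
    have s34 : Real.log (torusPartition (cubeCoupling J N) β h / torusPartition (cubeCoupling J N) β 0) ≤
        β * h * ((N : ℝ) ^ d * state J β h (spinAt 0)) :=
      s3.trans (mul_le_mul_of_nonneg_left s4 hβh.le)
    linarith
  have hX : torusExpect (torusCoupling J N) β 0 (fun σ => |totalSpin σ|) ≤
      (Real.log 2 + β * couplingDefect J N + β * h * ((N : ℝ) ^ d * state J β h (spinAt 0))) / (β * h) := by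
    rw [le_div_iff₀ hβh]
    linarith [key]
  refine hX.trans (le_of_eq ?_)
  have hβ0 : β ≠ 0 := hβ.ne'
  have hh0 : h ≠ 0 := hh.ne'
  field_simp
  ring

/-- **Step 4, squared form**: `⟨M²⟩_{𝕋_N,J^{(N)},0,β} ≤ N^d(N^d⟨σ₀⟩_{J,h,β} + D_N/h + log 2/(βh))`. [folklore] -/
theorem torusExpect_totalSpin_sq_le (hβ : 0 < β) {h : ℝ} (hh : 0 < h) (hJ : ∀ x y, 0 ≤ J x y)
    (hJt : ∀ a x y, J (x + a) (y + a) = J x y) (hJs : Summable (J 0)) :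
    torusExpect (torusCoupling J N) β 0 (fun σ => totalSpin σ ^ 2) ≤
      (N : ℝ) ^ d * ((N : ℝ) ^ d * state J β h (spinAt 0) + couplingDefect J N / h + Real.log 2 / (β * h)) := by
  have h1 : torusExpect (torusCoupling J N) β 0 (fun σ => totalSpin σ ^ 2) ≤
      torusExpect (torusCoupling J N) β 0 (fun σ => (N : ℝ) ^ d * |totalSpin σ|) :=
    torusExpect_mono _ β 0 fun σ => totalSpin_sq_le σ
  rw [torusExpect_const_mul] at h1
  exact h1.trans (mul_le_mul_of_nonneg_left (torusExpect_abs_totalSpin_le J N β hβ hh hJ hJt hJs) (by positivity))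

end FixedN

/-! ### Step 5: the coupling defect is `o(N^d)` for summable `J` -/

section Defect

variable (J : Site d → Site d → ℝ) (N : ℕ) [NeZero N]

/-- **Euclidean division on `ℤ^d`**: `w ↦ (w mod N, w div N)` is a bijection `ℤ^d ≃ 𝕋_N × ℤ^d` with
inverse `(a, z) ↦ ã + Nz`. [folklore] -/
def siteEquivTorusProd : Site d ≃ TorusSite d N × Site d where
  toFun w := (Torus.proj N w, fun i => w i / (N : ℤ))
  invFun p := torusLift N p.1 + (N : ℤ) • p.2
  left_inv w := by
    funext i
    simp only [Pi.add_apply, Pi.smul_apply, smul_eq_mul, torusLift, Torus.proj_apply]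
    rw [ZMod.val_intCast]
    exact Int.emod_add_mul_ediv (w i) N
  right_inv p := by
    obtain ⟨a, z⟩ := p
    have hN : (N : ℤ) ≠ 0 := by exact_mod_cast NeZero.ne N
    refine Prod.ext ?_ ?_
    · show Torus.proj N (torusLift N a + (N : ℤ) • z) = a
      rw [proj_add_eq, proj_torusLift]
      have h0 : Torus.proj N ((N : ℤ) • z) = 0 := by
        funext i
        simp [Torus.proj]
      rw [h0, add_zero]
    · funext i
      show (torusLift N a + (N : ℤ) • z) i / (N : ℤ) = z i
      simp only [Pi.add_apply, Pi.smul_apply, smul_eq_mul]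
      rw [Int.add_mul_ediv_left _ _ hN, Int.ediv_eq_zero_of_lt, zero_add]
      · exact ((mem_halfOpenBox.1 (torusLift_mem_halfOpenBox N a)) i).1
      · exact ((mem_halfOpenBox.1 (torusLift_mem_halfOpenBox N a)) i).2

omit [NeZero N] in
/-- Rows of a translation-invariant coupling with summable `J_{0,·}` are summable, with the same sum. [folklore] -/
theorem summable_row (hJt : ∀ a x y, J (x + a) (y + a) = J x y) (hJs : Summable (J 0)) (x : Site d) :
    Summable (J x) ∧ ∑' w, J x w = ∑' w, J 0 w := by
  have e : J x = fun w => J 0 (w + -x) := by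
    funext w
    rw [← hJt (-x) x w, add_neg_cancel]
  rw [e]
  exact ⟨(Equiv.addRight (-x)).summable_iff.2 hJs, (Equiv.addRight (-x)).tsum_eq (J 0)⟩

/-- **Row sums of `J^{(N)}` are full row sums of `J`**: `∑_{b∈𝕋_N} J^{(N)}_{a,b} = ∑_{w∈ℤ^d} J_{ã,w}`
(every `w` is uniquely `b̃ + Nz`). [cite: Panis2023Triviality, §3.1 (J^{(L)})] -/
theorem sum_torusCoupling_eq_tsum (hJt : ∀ a x y, J (x + a) (y + a) = J x y) (hJs : Summable (J 0))
    (a : TorusSite d N) : ∑ b, torusCoupling J N a b = ∑' w, J (torusLift N a) w := by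
  set x := torusLift N a with hx
  set e := siteEquivTorusProd (d := d) N with he
  have hrow := (summable_row J hJt hJs x).1
  have hf : Summable fun p : TorusSite d N × Site d => J x (e.symm p) := (e.symm.summable_iff).2 hrow
  have h1 : ∑' p : TorusSite d N × Site d, J x (e.symm p) = ∑' w, J x w := e.symm.tsum_eq (J x)
  rw [← h1, hf.tsum_prod' fun b => summable_coupling_add_smul J N hJt hJs x (torusLift N b), tsum_fintype]
  rfl

/-- Row sums of the transported cube coupling: `∑_b J_{ã,b̃} = ∑_{y∈[0,N)^d} J_{ã,y}`. [folklore] -/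
theorem sum_cubeCoupling_eq (a : TorusSite d N) :
    ∑ b, cubeCoupling J N a b = ∑ y ∈ halfOpenBox d N, J (torusLift N a) y := by
  rw [← Equiv.sum_comp (cubeEquivTorus N) (fun b => cubeCoupling J N a b), ← Finset.sum_coe_sort (halfOpenBox d N)]
  refine Finset.sum_congr rfl fun z _ => ?_
  simp only [cubeCoupling, cubeEquivTorus_apply]
  rw [torusLift_proj N z.2]

/-- Sums over the torus of functions of the representative are sums over the fundamental cube. [folklore] -/
theorem sum_comp_torusLift (F : Site d → ℝ) : ∑ a : TorusSite d N, F (torusLift N a) = ∑ x ∈ halfOpenBox d N, F x := by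
  rw [← Equiv.sum_comp (cubeEquivTorus N) (fun a => F (torusLift N a)), ← Finset.sum_coe_sort (halfOpenBox d N)]
  refine Finset.sum_congr rfl fun z _ => ?_
  simp only [cubeEquivTorus_apply]
  rw [torusLift_proj N z.2]

/-- The coupling defect as a sum of ROW DEFECTS over the fundamental cube:
`D_N = ∑_{x∈[0,N)^d}(∑_w J_{x,w} - ∑_{y∈[0,N)^d} J_{x,y})`. [folklore] -/
theorem couplingDefect_eq (hJt : ∀ a x y, J (x + a) (y + a) = J x y) (hJs : Summable (J 0)) :
    couplingDefect J N = ∑ x ∈ halfOpenBox d N, (∑' w, J x w - ∑ y ∈ halfOpenBox d N, J x y) := by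
  rw [couplingDefect]
  simp_rw [Finset.sum_sub_distrib, sum_torusCoupling_eq_tsum J N hJt hJs, sum_cubeCoupling_eq]
  have e1 : ∑ a : TorusSite d N, ∑' w, J (torusLift N a) w = ∑ x ∈ halfOpenBox d N, ∑' w, J x w :=
    sum_comp_torusLift N fun x => ∑' w, J x w
  have e2 : ∑ a : TorusSite d N, ∑ y ∈ halfOpenBox d N, J (torusLift N a) y =
      ∑ x ∈ halfOpenBox d N, ∑ y ∈ halfOpenBox d N, J x y :=
    sum_comp_torusLift N fun x => ∑ y ∈ halfOpenBox d N, J x y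
  rw [e1, e2]

omit [NeZero N] in
/-- A row defect is at most the full row sum `|J| = ∑_w J_{0,w}` (`J ≥ 0`). [folklore] -/
theorem rowDefect_le_tsum (hJ : ∀ x y, 0 ≤ J x y) (hJt : ∀ a x y, J (x + a) (y + a) = J x y)
    (hJs : Summable (J 0)) (x : Site d) :
    ∑' w, J x w - ∑ y ∈ halfOpenBox d N, J x y ≤ ∑' w, J 0 w := by
  rw [← (summable_row J hJt hJs x).2]
  linarith [Finset.sum_nonneg fun y (_ : y ∈ halfOpenBox d N) => hJ x y]

omit [NeZero N] in
/-- **Deep sites have small row defect**: if `x + Λ_K ⊆ [0,N)^d` then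
`∑_w J_{x,w} - ∑_{y∈[0,N)^d} J_{x,y} ≤ ∑_{u∉Λ_K} J_{0,u}` (the tail of `J`). [folklore] -/
theorem rowDefect_le_tail (hJ : ∀ x y, 0 ≤ J x y) (hJt : ∀ a x y, J (x + a) (y + a) = J x y)
    (hJs : Summable (J 0)) {K : ℕ} {x : Site d} (hdeep : ∀ i, (K : ℤ) ≤ x i ∧ x i + K < N) :
    ∑' w, J x w - ∑ y ∈ halfOpenBox d N, J x y ≤ ∑' u : {u // u ∉ box d K}, J 0 u := by
  have hrow := (summable_row J hJt hJs x).1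
  have hsplit := hrow.sum_add_tsum_compl (s := halfOpenBox d N)
  have hdef : ∑' w, J x w - ∑ y ∈ halfOpenBox d N, J x y = ∑' w : ↑((halfOpenBox d N : Set (Site d))ᶜ), J x w := by
    linarith
  rw [hdef]
  -- compare along the injection `w ↦ w - x` into the complement of `Λ_K`
  have hmem : ∀ w : Site d, w ∉ halfOpenBox d N → w - x ∉ box d K := by
    intro w hw hwx
    apply hw
    rw [mem_box] at hwx
    rw [mem_halfOpenBox]
    intro i
    have h1 := hwx i
    simp only [Pi.sub_apply] at h1
    constructor <;> linarith [(hdeep i).1, (hdeep i).2, h1.1, h1.2]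
  set ι : ↑((halfOpenBox d N : Set (Site d))ᶜ) → {u // u ∉ box d K} :=
    fun w => ⟨(w : Site d) - x, hmem w (fun h => w.2 (Finset.mem_coe.2 h))⟩ with hι
  have hιinj : Function.Injective ι := by
    intro w w' h
    have h' : (w : Site d) - x = (w' : Site d) - x := congrArg Subtype.val h
    exact Subtype.ext (sub_left_injective h')
  refine Summable.tsum_le_tsum_of_inj ι hιinj (fun u _ => hJ 0 u) (fun w => ?_) (hrow.subtype _) (hJs.subtype _)
  show J x w ≤ J 0 ((w : Site d) - x)
  rw [← hJt (-x) x w, add_neg_cancel, ← sub_eq_add_neg]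

omit [NeZero N] in
/-- The tails `∑_{u∉Λ_K} J_{0,u}` of a summable coupling tend to `0`. [folklore] -/
theorem tendsto_tail_box :
    Tendsto (fun K : ℕ => ∑' u : {u // u ∉ box d K}, J 0 u) atTop (𝓝 0) := by
  have h1 := tendsto_tsum_compl_atTop_zero (J 0)
  have h2 : Tendsto (box d) atTop atTop :=
    (box_mono d).tendsto_atTop_atTop fun s => by
      obtain ⟨L₀, hL₀⟩ := exists_forall_subset_box d s
      exact ⟨L₀, hL₀ L₀ le_rfl⟩
  exact h1.comp h2

/-- **The coupling defect at scale `K`**: for `2K ≤ N`,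
`D_N ≤ N^d ∑_{u∉Λ_K}J_{0,u} + (N^d - (N-2K)^d)|J|`. [folklore] -/
theorem couplingDefect_le (hJ : ∀ x y, 0 ≤ J x y) (hJt : ∀ a x y, J (x + a) (y + a) = J x y)
    (hJs : Summable (J 0)) {K : ℕ} (hK : 2 * K ≤ N) :
    couplingDefect J N ≤ (N : ℝ) ^ d * ∑' u : {u // u ∉ box d K}, J 0 u +
      ((N : ℝ) ^ d - ((N : ℝ) - 2 * K) ^ d) * ∑' w, J 0 w := by
  set I : Finset (Site d) := Fintype.piFinset fun _ : Fin d => Finset.Ico (K : ℤ) ((N : ℤ) - K) with hI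
  set tail : ℝ := ∑' u : {u // u ∉ box d K}, J 0 u with htail
  set S : ℝ := ∑' w, J 0 w with hS
  have hIsub : I ⊆ halfOpenBox d N := by
    intro x hx
    rw [hI, Fintype.mem_piFinset] at hx
    rw [mem_halfOpenBox]
    intro i
    have := Finset.mem_Ico.1 (hx i)
    constructor <;> linarith [this.1, this.2]
  have hIcard : #I = (N - 2 * K) ^ d := by
    rw [hI, Fintype.card_piFinset_const, Int.card_Ico]
    congr 1
    omega
  have hdeepI : ∀ x ∈ I, ∑' w, J x w - ∑ y ∈ halfOpenBox d N, J x y ≤ tail := by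
    intro x hx
    rw [hI, Fintype.mem_piFinset] at hx
    refine rowDefect_le_tail J N hJ hJt hJs fun i => ?_
    have := Finset.mem_Ico.1 (hx i)
    exact ⟨this.1, by linarith [this.2]⟩
  have htail0 : 0 ≤ tail := tsum_nonneg fun u => hJ 0 u
  have hS0 : 0 ≤ S := tsum_nonneg fun w => hJ 0 w
  rw [couplingDefect_eq J N hJt hJs, ← Finset.sum_sdiff hIsub]
  have hA : ∑ x ∈ halfOpenBox d N \ I, (∑' w, J x w - ∑ y ∈ halfOpenBox d N, J x y) ≤
      ((N : ℝ) ^ d - ((N : ℝ) - 2 * K) ^ d) * S := by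
    refine (Finset.sum_le_sum fun x _ => rowDefect_le_tsum J N hJ hJt hJs x).trans ?_
    rw [Finset.sum_const, nsmul_eq_mul, Finset.card_sdiff_of_subset hIsub, card_halfOpenBox, hIcard,
      Nat.cast_sub (Nat.pow_le_pow_left (by omega) d)]
    push_cast
    rw [Nat.cast_sub (by omega)]
    push_cast
    rfl
  have hB : ∑ x ∈ I, (∑' w, J x w - ∑ y ∈ halfOpenBox d N, J x y) ≤ (N : ℝ) ^ d * tail := by
    refine (Finset.sum_le_sum hdeepI).trans ?_
    rw [Finset.sum_const, nsmul_eq_mul, hIcard]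
    refine mul_le_mul_of_nonneg_right ?_ htail0
    exact_mod_cast Nat.pow_le_pow_left (by omega : N - 2 * K ≤ N) d
  linarith

omit [NeZero N] in
/-- **Step 5: `D_N = o(N^d)`** for `J ≥ 0` translation invariant with `J_{0,·}` summable: for every
`ε > 0`, `D_N ≤ εN^d` for all large `N`. [folklore] -/
theorem couplingDefect_le_eventually (hJ : ∀ x y, 0 ≤ J x y) (hJt : ∀ a x y, J (x + a) (y + a) = J x y)
    (hJs : Summable (J 0)) {ε : ℝ} (hε : 0 < ε) :
    ∃ N₀ : ℕ, ∀ M : ℕ, [NeZero M] → N₀ ≤ M → couplingDefect J M ≤ ε * (M : ℝ) ^ d := by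
  set S : ℝ := ∑' w, J 0 w with hS
  have hS0 : 0 ≤ S := tsum_nonneg fun w => hJ 0 w
  -- a scale `K` with a small tail
  obtain ⟨K, hK⟩ : ∃ K : ℕ, ∑' u : {u // u ∉ box d K}, J 0 u ≤ ε / 2 := by
    have h := (tendsto_order.1 (tendsto_tail_box J)).2 (ε / 2) (by linarith)
    obtain ⟨K, hK⟩ := h.exists
    exact ⟨K, hK.le⟩
  -- the boundary layer is negligible: `1 - ((M-2K)/M)^d → 0`
  have hlim : Tendsto (fun M : ℕ => (1 - (((M : ℝ) - 2 * K) / M) ^ d) * S) atTop (𝓝 0) := by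
    have h1 : Tendsto (fun M : ℕ => ((M : ℝ) - 2 * K) / M) atTop (𝓝 1) := by
      have h2 : Tendsto (fun M : ℕ => 1 - (2 * K : ℝ) / M) atTop (𝓝 (1 - 0)) :=
        tendsto_const_nhds.sub (tendsto_const_div_atTop_nhds_zero_nat _)
      rw [sub_zero] at h2
      refine h2.congr' ?_
      filter_upwards [eventually_ge_atTop 1] with M hM
      have hM0 : (M : ℝ) ≠ 0 := by exact_mod_cast (show M ≠ 0 by omega)
      field_simp
    have h3 : Tendsto (fun M : ℕ => (1 - (((M : ℝ) - 2 * K) / M) ^ d) * S) atTop (𝓝 ((1 - 1 ^ d) * S)) :=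
      (tendsto_const_nhds.sub (h1.pow d)).mul tendsto_const_nhds
    simpa using h3
  obtain ⟨N₁, hN₁⟩ : ∃ N₁ : ℕ, ∀ M, N₁ ≤ M → (1 - (((M : ℝ) - 2 * K) / M) ^ d) * S ≤ ε / 2 := by
    have h := (tendsto_order.1 hlim).2 (ε / 2) (by linarith)
    obtain ⟨N₁, hN₁⟩ := eventually_atTop.1 h
    exact ⟨N₁, fun M hM => (hN₁ M hM).le⟩
  refine ⟨max N₁ (2 * K + 1), fun M _ hM => ?_⟩
  have hMK : 2 * K ≤ M := by omega
  have hM1 : N₁ ≤ M := le_of_max_le_left hM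
  have hMpos : (0 : ℝ) < M := by exact_mod_cast (show 0 < M by omega)
  have hb := couplingDefect_le J M hJ hJt hJs hMK
  have hlayer : ((M : ℝ) ^ d - ((M : ℝ) - 2 * K) ^ d) * S = (M : ℝ) ^ d * ((1 - (((M : ℝ) - 2 * K) / M) ^ d) * S) := by
    rw [div_pow]
    field_simp
  rw [hlayer] at hb
  have h1 : (M : ℝ) ^ d * ∑' u : {u // u ∉ box d K}, J 0 u ≤ (M : ℝ) ^ d * (ε / 2) :=
    mul_le_mul_of_nonneg_left hK (by positivity)
  have h2 : (M : ℝ) ^ d * ((1 - (((M : ℝ) - 2 * K) / M) ^ d) * S) ≤ (M : ℝ) ^ d * (ε / 2) :=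
    mul_le_mul_of_nonneg_left (hN₁ M hM1) (by positivity)
  linarith

end Defect

/-! ### Step 6: the zero mode below `β_c` -/

section ZeroMode

variable (J : Site d → Site d → ℝ) (β : ℝ)

/-- **Below `β_c` the magnetisation vanishes**: `m*(β) = 0` for `0 < β < β_c` (`J ≥ 0`; the
definition `β_c = inf{β > 0 : m*(β) > 0}` and `m* ≥ 0`). [cite: Panis2023Triviality, §1.2.1 (β_c := inf{β > 0 : m*(β) > 0})] -/
theorem magnetization_eq_zero_of_lt_criticalBeta (hβ : 0 < β) (hβc : β < LongRangeIsing.criticalBeta J)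
    (hJ : ∀ x y, 0 ≤ J x y) : magnetization J β = 0 := by
  by_contra hne
  have hpos : 0 < magnetization J β := lt_of_le_of_ne (magnetization_nonneg J β hβ.le hJ) (Ne.symm hne)
  have hle : LongRangeIsing.criticalBeta J ≤ β :=
    csInf_le ⟨0, fun b hb => hb.1.le⟩ ⟨hβ, hpos⟩
  linarith

/-- **The torus block moment is `o(N^{2d})` when `m*(β) = 0`**: for `β > 0`, `J ≥ 0` translation
invariant with `J_{0,·}` summable and `m*(β) = 0`, for every `ε > 0`,
`⟨(∑_{a∈𝕋_N}σ_a)²⟩_{𝕋_N,J^{(N)},0,β} ≤ εN^{2d}` for all large `N`.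
[cite: AizenmanDuminilCopinSidoraviciusCMP2015, §3.3 eq. (3.17)] -/
theorem torusExpect_totalSpin_sq_le_eventually (hd : 1 ≤ d) (hβ : 0 < β) (hJ : ∀ x y, 0 ≤ J x y)
    (hJt : ∀ a x y, J (x + a) (y + a) = J x y) (hJs : Summable (J 0)) (hm : magnetization J β = 0)
    {ε : ℝ} (hε : 0 < ε) :
    ∃ N₀ : ℕ, ∀ M : ℕ, [NeZero M] → N₀ ≤ M →
      torusExpect (torusCoupling J M) β 0 (fun σ => totalSpin σ ^ 2) ≤ ε * ((M : ℝ) ^ d) ^ 2 := by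
  -- a field `h > 0` with `m(h) ≤ ε/3`
  obtain ⟨h, hh, hmh⟩ : ∃ h : ℝ, 0 < h ∧ state J β h (spinAt 0) ≤ ε / 3 := by
    have ht := tendsto_state_magnetization J β hβ.le hJ
    rw [hm] at ht
    have hev := (tendsto_order.1 ht).2 (ε / 3) (by linarith)
    obtain ⟨h, hh1, hh2⟩ := (hev.and self_mem_nhdsWithin).exists
    exact ⟨h, hh2, hh1.le⟩
  -- `D_M ≤ (εh/3) M^d` and `log 2/(βh) ≤ (ε/3) M^d` for large `M`
  obtain ⟨N₁, hN₁⟩ := couplingDefect_le_eventually J hJ hJt hJs (show 0 < ε * h / 3 by positivity)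
  obtain ⟨N₂, hN₂⟩ : ∃ N₂ : ℕ, ∀ M : ℕ, N₂ ≤ M → Real.log 2 / (β * h) ≤ ε / 3 * (M : ℝ) ^ d := by
    obtain ⟨N₂, hN₂⟩ := exists_nat_ge (Real.log 2 / (β * h) / (ε / 3))
    refine ⟨max N₂ 1, fun M hM => ?_⟩
    have hM1 : (1 : ℝ) ≤ M := by exact_mod_cast le_of_max_le_right hM
    have hMge : (N₂ : ℝ) ≤ M := by exact_mod_cast le_of_max_le_left hM
    have hMd : (M : ℝ) ≤ (M : ℝ) ^ d := by simpa using pow_le_pow_right₀ hM1 hd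
    have hq : Real.log 2 / (β * h) ≤ ε / 3 * M := by
      have := hN₂.trans hMge
      rw [div_le_iff₀ (by positivity : (0 : ℝ) < ε / 3)] at this
      linarith
    exact hq.trans (mul_le_mul_of_nonneg_left hMd (by positivity))
  refine ⟨max N₁ N₂, fun M _ hM => ?_⟩
  have hb := torusExpect_totalSpin_sq_le J M β hβ hh hJ hJt hJs
  have hD := hN₁ M (le_of_max_le_left hM)
  have hL := hN₂ M (le_of_max_le_right hM)
  have hMd0 : (0 : ℝ) ≤ (M : ℝ) ^ d := by positivity
  have h1 : (M : ℝ) ^ d * state J β h (spinAt 0) ≤ (M : ℝ) ^ d * (ε / 3) := mul_le_mul_of_nonneg_left hmh hMd0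
  have h2 : couplingDefect J M / h ≤ ε / 3 * (M : ℝ) ^ d := by
    rw [div_le_iff₀ hh]
    linarith
  calc torusExpect (torusCoupling J M) β 0 (fun σ => totalSpin σ ^ 2)
      ≤ (M : ℝ) ^ d * ((M : ℝ) ^ d * state J β h (spinAt 0) + couplingDefect J M / h + Real.log 2 / (β * h)) := hb
    _ ≤ (M : ℝ) ^ d * ((M : ℝ) ^ d * (ε / 3) + ε / 3 * (M : ℝ) ^ d + ε / 3 * (M : ℝ) ^ d) := by
        gcongr
    _ = ε * ((M : ℝ) ^ d) ^ 2 := by ring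

end ZeroMode

/-! ### The zero mode of the torus two-point function -/

section ZeroModeIdentity

variable {N : ℕ} [NeZero N] (c : TorusSite d N → TorusSite d N → ℝ) (β h : ℝ)

/-- **`⟨M²⟩ = N^d ∑_u⟨σ₀σ_u⟩`** for a translation-invariant coupling matrix (the zero mode
`Ŝ(0) = ∑_x⟨σ₀σ_x⟩_{𝕋_N}` of the torus two-point function). [cite: Panis2023Triviality, §3.3 (Ŝ^{(L)}(p) = ⟨|τ̂(p)|²⟩, p = 0)] -/
theorem torusExpect_totalSpin_sq_eq (hc : ∀ a b t, c (a + t) (b + t) = c a b) :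
    torusExpect c β h (fun σ => totalSpin σ ^ 2) =
      (N : ℝ) ^ d * ∑ u, torusExpect c β h (fun σ => spinAt 0 σ * spinAt u σ) := by
  have h1 : (fun σ : SpinConfig (TorusSite d N) => totalSpin σ ^ 2) = fun σ => ∑ a, ∑ b, spinAt a σ * spinAt b σ := by
    funext σ
    rw [totalSpin, sq, Finset.sum_mul_sum]
  have h2 : ∀ a b : TorusSite d N, torusExpect c β h (fun σ => spinAt a σ * spinAt b σ) =
      torusExpect c β h (fun σ => spinAt 0 σ * spinAt (b - a) σ) := by
    intro a b
    have e : (fun σ : SpinConfig (TorusSite d N) => spinAt a σ * spinAt b σ) =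
        fun σ => (fun τ => spinAt 0 τ * spinAt (b - a) τ) (σ ∘ Equiv.addRight a) := by
      funext σ
      show _ = spinAt (Equiv.addRight a 0) σ * spinAt (Equiv.addRight a (b - a)) σ
      simp
    rw [e]
    exact torusExpect_comp_equiv c β h (Equiv.addRight a) (fun x y => hc x y a) (fun τ => spinAt 0 τ * spinAt (b - a) τ)
  have h3 : ∀ a : TorusSite d N, ∑ b, torusExpect c β h (fun σ => spinAt 0 σ * spinAt (b - a) σ) =
      ∑ u, torusExpect c β h (fun σ => spinAt 0 σ * spinAt u σ) :=
    fun a => Equiv.sum_comp (Equiv.subRight a) (fun u => torusExpect c β h (fun σ => spinAt 0 σ * spinAt u σ))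
  calc torusExpect c β h (fun σ => totalSpin σ ^ 2)
      = torusExpect c β h (fun σ => ∑ a, ∑ b, spinAt a σ * spinAt b σ) := by rw [h1]
    _ = ∑ a, torusExpect c β h (fun σ => ∑ b, spinAt a σ * spinAt b σ) :=
        torusExpect_finset_sum c β h univ (fun a σ => ∑ b, spinAt a σ * spinAt b σ)
    _ = ∑ a, ∑ b, torusExpect c β h (fun σ => spinAt a σ * spinAt b σ) :=
        Finset.sum_congr rfl fun a _ => torusExpect_finset_sum c β h univ (fun b σ => spinAt a σ * spinAt b σ)
    _ = ∑ a, ∑ b, torusExpect c β h (fun σ => spinAt 0 σ * spinAt (b - a) σ) :=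
        Finset.sum_congr rfl fun a _ => Finset.sum_congr rfl fun b _ => h2 a b
    _ = ∑ _a : TorusSite d N, ∑ u, torusExpect c β h (fun σ => spinAt 0 σ * spinAt u σ) :=
        Finset.sum_congr rfl fun a _ => h3 a
    _ = (N : ℝ) ^ d * ∑ u, torusExpect c β h (fun σ => spinAt 0 σ * spinAt u σ) := by
        rw [Finset.sum_const, Finset.card_univ, card_torus, nsmul_eq_mul]
        push_cast
        ring

end ZeroModeIdentity

section ZeroModeLimit

variable (J : Site d → Site d → ℝ) (β : ℝ)

/-- **The torus zero mode is `o(N^d)` when `m*(β) = 0`** (long-range analogue of ADS15 (3.17),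
`limsup L^{-d}F̂_{L,β}(0) ≤ 0` below `β_c`): for `d ≥ 1`, `β > 0`, `J ≥ 0` translation invariant
with `J_{0,·}` summable and `m*(β) = 0`, for every `ε > 0`,
`∑_{u∈𝕋_N}⟨σ₀σ_u⟩_{𝕋_N,J^{(N)},0,β} ≤ εN^d` for all large `N`.
[cite: AizenmanDuminilCopinSidoraviciusCMP2015, §3.3 eq. (3.17)] -/
theorem torus_zeroMode_le_eventually (hd : 1 ≤ d) (hβ : 0 < β) (hJ : ∀ x y, 0 ≤ J x y)
    (hJt : ∀ a x y, J (x + a) (y + a) = J x y) (hJs : Summable (J 0)) (hm : magnetization J β = 0)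
    {ε : ℝ} (hε : 0 < ε) :
    ∃ N₀ : ℕ, ∀ M : ℕ, [NeZero M] → N₀ ≤ M →
      ∑ u, torusExpect (torusCoupling J M) β 0 (fun σ => spinAt 0 σ * spinAt u σ) ≤ ε * (M : ℝ) ^ d := by
  obtain ⟨N₀, hN₀⟩ := torusExpect_totalSpin_sq_le_eventually J β hd hβ hJ hJt hJs hm hε
  refine ⟨max N₀ 1, fun M _ hM => ?_⟩
  have hb := hN₀ M (le_of_max_le_left hM)
  rw [torusExpect_totalSpin_sq_eq _ β 0 (fun a b t => torusCoupling_add_right J M hJt a b t)] at hb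
  have hMd : (0 : ℝ) < (M : ℝ) ^ d := by
    have : (0 : ℝ) < M := by exact_mod_cast (show 0 < M from le_of_max_le_right hM)
    positivity
  rw [sq, ← mul_assoc, mul_comm ε, mul_assoc] at hb
  exact le_of_mul_le_mul_left hb hMd

end ZeroModeLimit

end LongRangeIsing

end Literature.Barriers.CriticalPhenomena
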